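import Summits.QuantumFields.BalabanUV.T4Continuum.Support.NE7HintOfLandauELChartSU2
import Summits.QuantumFields.BalabanUV.T4Continuum.Support.NE7CubeLandauChart
import HarnessLib

/-!
# Support | NE7 END OF RECORD over `NE7HintOfLandauELChartSU2`: the chart input (LSUP-EL) DISCHARGED, `SU(2)`/`U(2)`, d = 4

Informal class name: ROW NE7's HINT THEOREM WITH THE LANDAU-CHART INPUT SUPPLIED BY THE ONE-SCALE LATTICE UHLENBECK LEMMA.

`NE7HintOfLandauELChartSU2.hint_of_landauELChart_SU2` (the cell's previous END of the NE7 record) takes two inputs: the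
local chart hypothesis (LSUP-EL) — around every centre `z`, a unitary gauge in which the minimiser is `e^{A}` with `A` skew,
`‖A‖ ≤ c₀·t/2^{k+1}` and the Euler–Lagrange (Landau) condition of the trace link functional on the cube of radius
`(nbRad + 2ℓ + 12)·2^{k+1} + 2` — and ROW NE3's per-pair binder `hleaves`.  This file DISCHARGES (LSUP-EL): it is supplied,
for every small-field configuration, by the cube Landau chart `NE7CubeLandauChart.cube_landau_chart` (comb gauge + principal
logarithms + the one-scale lattice Uhlenbeck lemma `NE7LatticeUhlenbeckBox.uhlenbeck_box` by incremental minimisation of the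
free-boundary trace link functional + the a priori sup letter `NE7BoxLandauSupAPriori`), with `c₀ = 16384·(2·nbRad + 4ℓ + 28)`
(linear in `ℓ`, as the quantifier order of F306 allows) once `ε ≤ 1/(2.5·10¹⁰·(2·nbRad + 4ℓ + 28)²)`.

THE NEW END OF THE NE7 RECORD: `hint_SU2` — F306's statement with the (LSUP-EL) hypothesis and the constant `c₀` removed; the
only remaining input is ROW NE3's per-pair binder `hleaves` (verbatim as in F306).

HONEST LABEL: finite T⁴ rung (B)+1 — NOT infinite volume, NOT mass gap, NOT `BetaPertH`, NOT Clay.  No `sorry`; axioms ⊆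
{propext, Classical.choice, Quot.sound}.

Worked on by: prover-b2b-balaban-t4-ne7-p1-g93-0 (lineage b2b-balaban-t4-ne7-p1, gen 93: F314b, the END over F306).
-/

open scoped BigOperators Matrix Matrix.Norms.L2Operator Topology
open NormedSpace Finset Set Filter

namespace Summit.QuantumFields.BalabanUV.T4Continuum.NE7HintOfUhlenbeckChartSU2

open Literature.MathematicalPhysics.QuantumFieldTheory.Balaban1983to89
open B7Prop1Explicit B7Prop2Explicit MatrixLog UnitaryModel MatrixNorms
open B4TorusKernel.MultiPeriod (torusSupNorm)
open B8Ineq132 (covDiv)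
open T4AveragingDeficitWall (Ad IsUnitaryCfg IsSkewDir SmallField vary curl curlSq dirSq dirL1)
open T4AveragingDeficitWallBoundary (IsPeriodicCfg periodBox)
open AveragingDeficitPeriodicCounting (IsPeriodicDir)
open AveragingDeficitMultiLevelPrep (LevelSmall tower TangentIter)
open BlockAverageVaryHolo (nbRad)
open MinimalActionLevels (perWin)
open MinimalActionSandwich (IsMinimiser admissible)
open MinimalActionRate (sfClass)
open NE3HessForm (dAction)
open NE3SlicePoincareBudgetLine (CPLine)
open NE3TangentCovariantTower (dirIter)
open NE3DecomposedRepOfLinearNormalPart (ResidualSliceRepT)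
open NE3QbarIterCovLiftPrep (cruxC)
open NE3SmoothRightInverseW (rightInvW)
open NE3RightInverseSolveLetters (thetaLoc)
open NE3RightInverseL2Letter (l2C)
open NE3HatInvCurlLetters (curl2C curl1C)
open NE3EnergyShapes (IsUnitarySite)
open NE7HintOfLandauELChartSU2 (hint_of_landauELChart_SU2)
open NE7CubeLandauChart (cube_landau_chart)

variable {n : Type*} [Fintype n] [DecidableEq n]

/-- **THE REGIME ARITHMETIC** of the cube chart at level `k`: with `M = 2^{k+1} ≥ 2`, `X = 2R+3 ≤ cM`, `X₂ = 2R+2 ≤ cM`, `1 ≤ X`,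
`1 ≤ c`, `η > 0`, `M²η = t₀ ≤ (5/4)ε` and `ε ≤ 1/(2.5·10¹⁰ c²)`: the four inequalities fed to `cube_landau_chart` with `ε′ = 2η`
and the final letter `128·4³·X·(2η) ≤ 16384·c·t₀/M`. [folklore] -/
theorem regime_arith {M X X₂ c η t₀ ε Nn : ℝ} (hM : 2 ≤ M) (hX : X ≤ c * M) (hX1 : 1 ≤ X) (hX₂ : X₂ ≤ c * M) (hX₂0 : 0 ≤ X₂)
    (hc : 1 ≤ c) (hη : 0 < η) (ht₀ : M ^ 2 * η = t₀) (ht₀ε : t₀ ≤ 5 / 4 * ε) (hε : ε ≤ 1 / (25000000000 * c ^ 2)) (hNn : Nn = 2) :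
    η + 8 * (Real.pi / 2 * (3 * X₂ * η)) * (Real.exp (4 * (Real.pi / 2 * (3 * X₂ * η))) - 1) ≤ 2 * η ∧
    576 * (64 * ((4 : ℕ) : ℝ) ^ 3 * X) ^ 2 * (2 * η) ≤ 1 ∧
    Nn * (1 + 2 * ((4 : ℕ) : ℝ) * X) * (256 * ((4 : ℕ) : ℝ) ^ 3 * X * (2 * η)) ≤ 1 / 2 ∧
    128 * ((4 : ℕ) : ℝ) ^ 3 * X * (2 * η) ≤ 16384 * c * t₀ / M := by
  have hM0 : 0 < M := by linarith
  have hc0 : 0 < c := by linarith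
  have ht₀0 : 0 < t₀ := by rw [← ht₀]; positivity
  have hε0 : 0 < ε := by linarith
  -- `c² t₀ ≤ 5·10⁻¹¹`
  have hct : c ^ 2 * t₀ ≤ 1 / 20000000000 := by
    have h1 : c ^ 2 * t₀ ≤ c ^ 2 * (5 / 4 * ε) := mul_le_mul_of_nonneg_left ht₀ε (by positivity)
    have h2 : c ^ 2 * ε ≤ c ^ 2 * (1 / (25000000000 * c ^ 2)) := mul_le_mul_of_nonneg_left hε (by positivity)
    have h3 : c ^ 2 * (1 / (25000000000 * c ^ 2)) = 1 / 25000000000 := by field_simp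
    linarith
  have hct' : c * t₀ ≤ 1 / 20000000000 := by nlinarith
  -- `Mη = t₀/M ≤ t₀/2`, `X η ≤ c t₀ / M`, `X² η ≤ c² t₀`
  have hMη : M * η = t₀ / M := by rw [← ht₀]; field_simp
  have hMη' : M * η ≤ t₀ / 2 := by rw [hMη]; exact div_le_div_of_nonneg_left ht₀0.le (by norm_num) hM
  have hXη : X * η ≤ c * (t₀ / M) := by
    calc X * η ≤ c * M * η := mul_le_mul_of_nonneg_right hX hη.le
      _ = c * (t₀ / M) := by rw [mul_assoc, hMη]
  have hX₂η : X₂ * η ≤ c * (t₀ / M) := by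
    calc X₂ * η ≤ c * M * η := mul_le_mul_of_nonneg_right hX₂ hη.le
      _ = c * (t₀ / M) := by rw [mul_assoc, hMη]
  have htM : t₀ / M ≤ t₀ / 2 := div_le_div_of_nonneg_left ht₀0.le (by norm_num) hM
  have hX2η : X ^ 2 * η ≤ c ^ 2 * t₀ := by
    have hX0 : 0 ≤ X := by linarith
    calc X ^ 2 * η = X * (X * η) := by ring
      _ ≤ (c * M) * (c * (t₀ / M)) := mul_le_mul hX hXη (by positivity) (by positivity)
      _ = c ^ 2 * t₀ := by field_simp
  -- the logarithm letter `b₀ = (π/2)·3X₂η ≤ 6 c t₀/M ≤ 3 c t₀`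
  set b₀ : ℝ := Real.pi / 2 * (3 * X₂ * η) with hb₀
  have hb₀0 : 0 ≤ b₀ := by positivity
  have hb₀le : b₀ ≤ 6 * (c * (t₀ / M)) := by
    rw [hb₀]
    have h1 : Real.pi / 2 ≤ 2 := by linarith [Real.pi_le_four]
    calc Real.pi / 2 * (3 * X₂ * η) ≤ 2 * (3 * X₂ * η) := mul_le_mul_of_nonneg_right h1 (by positivity)
      _ = 6 * (X₂ * η) := by ring
      _ ≤ 6 * (c * (t₀ / M)) := by linarith
  have hb₀' : b₀ ≤ 3 * (c * t₀) := by
    have : c * (t₀ / M) ≤ c * (t₀ / 2) := mul_le_mul_of_nonneg_left htM hc0.le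
    linarith
  have h4b₀ : 4 * b₀ ≤ 1 := by linarith
  have hexp : Real.exp (4 * b₀) - 1 ≤ 8 * b₀ := by
    have h := Real.abs_exp_sub_one_le (x := 4 * b₀) (by rw [abs_of_nonneg (by positivity)]; exact h4b₀)
    rw [abs_of_nonneg (by positivity : (0 : ℝ) ≤ 4 * b₀)] at h
    linarith [le_abs_self (Real.exp (4 * b₀) - 1)]
  have hb₀sq : b₀ * b₀ ≤ 36 * (c ^ 2 * t₀) * η := by
    have h1 : b₀ * b₀ ≤ (6 * (c * (t₀ / M))) * (6 * (c * (t₀ / M))) := mul_le_mul hb₀le hb₀le hb₀0 (by positivity)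
    have h2 : (6 * (c * (t₀ / M))) * (6 * (c * (t₀ / M))) = 36 * (c ^ 2 * t₀) * η := by
      rw [← hMη, ← ht₀]; ring
    linarith
  refine ⟨?_, ?_, ?_, ?_⟩
  · -- `8 b₀ (e^{4b₀} − 1) ≤ 64 b₀² ≤ η`
    have h1 : 8 * b₀ * (Real.exp (4 * b₀) - 1) ≤ 8 * b₀ * (8 * b₀) := mul_le_mul_of_nonneg_left hexp (by positivity)
    have h2 : 64 * (b₀ * b₀) ≤ 64 * (36 * (c ^ 2 * t₀) * η) := by linarith
    have h3 : 64 * (36 * (c ^ 2 * t₀) * η) ≤ η := by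
      have h5 : 64 * (36 * (c ^ 2 * t₀)) ≤ 1 := by linarith
      have h6 : 64 * (36 * (c ^ 2 * t₀) * η) = (64 * (36 * (c ^ 2 * t₀))) * η := by ring
      rw [h6]
      calc (64 * (36 * (c ^ 2 * t₀))) * η ≤ 1 * η := mul_le_mul_of_nonneg_right h5 hη.le
        _ = η := one_mul η
    have h4 : 8 * b₀ * (8 * b₀) = 64 * (b₀ * b₀) := by ring
    show η + 8 * b₀ * (Real.exp (4 * b₀) - 1) ≤ 2 * η
    linarith
  · -- (R1): `576·4096²·X²·2η ≤ 576·4096²·2·c²t₀ ≤ 1`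
    have h1 : 576 * (64 * ((4 : ℕ) : ℝ) ^ 3 * X) ^ 2 * (2 * η) = 19327352832 * (X ^ 2 * η) := by push_cast; ring
    rw [h1]; linarith
  · -- (R2): `2·(1 + 8X)·32768·X·2η ≤ 2·9X·32768X·2η = 589824 X²η ≤ 1/2`
    rw [hNn]
    simp only [Nat.cast_ofNat]
    have hX0 : 0 ≤ X := by linarith
    have h1 : (2 : ℝ) * (1 + 2 * 4 * X) * (256 * 4 ^ 3 * X * (2 * η)) ≤ 2 * (9 * X) * (256 * 4 ^ 3 * X * (2 * η)) := by
      have : (1 : ℝ) + 2 * 4 * X ≤ 9 * X := by linarith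
      have h0 : (0 : ℝ) ≤ 256 * 4 ^ 3 * X * (2 * η) := by positivity
      nlinarith
    have h2 : (2 : ℝ) * (9 * X) * (256 * 4 ^ 3 * X * (2 * η)) = 589824 * (X ^ 2 * η) := by ring
    linarith
  · -- the letter: `16384 X η ≤ 16384 c t₀/M`
    have h1 : 128 * ((4 : ℕ) : ℝ) ^ 3 * X * (2 * η) = 16384 * (X * η) := by push_cast; ring
    rw [h1]
    calc (16384 : ℝ) * (X * η) ≤ 16384 * (c * (t₀ / M)) := by linarith
      _ = 16384 * c * t₀ / M := by ring

/-- **ROW NE7's END OF RECORD, THE LANDAU-CHART INPUT DISCHARGED**: F306 `hint_of_landauELChart_SU2` with its hypothesis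
(LSUP-EL) supplied by the cube Landau chart `NE7CubeLandauChart.cube_landau_chart` (one-scale lattice Uhlenbeck lemma); the
only remaining input is ROW NE3's per-pair binder `hleaves`. [folklore] -/
theorem hint_SU2 [Nonempty n] (hn : Fintype.card n = 2) :
    ∃ ℓ : ℕ, 1 ≤ ℓ ∧ ∃ ε₀ : ℝ, 0 < ε₀ ∧ ∀ ε : ℝ, 0 < ε → ε ≤ ε₀ → ∃ β₀ : ℝ, 0 < β₀ ∧ ∀ β : ℝ, 0 < β → β ≤ β₀ →
    ∀ (N : ℕ) [NeZero N] (C₂ αh Ch νh κh : ℝ), 1 ≤ N →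
    0 ≤ C₂ → 0 ≤ αh → αh ≤ 1 → 0 ≤ Ch →
    νh = 2 * Real.sqrt (l2C 4 2 / (1 - thetaLoc 4 2 * ε) ^ 2 + curl2C 4 2 / (1 - thetaLoc 4 2 * ε) ^ 2) * C₂ * Ch * αh →
    κh = 4 * (curl1C 4 2 / (1 - thetaLoc 4 2 * ε)) * C₂ * Ch ^ 2 * ε →
    νh < 1 →
    2 * (κh / (1 - νh) ^ 2) < ((((1 / 2 - (νh / (1 - νh)) ^ 2) / (2 * (1 + (CPLine 4 2 2 (1 / 10 ^ 17) (1 / 10 ^ 53) + 1))) - (νh / (1 - νh)) ^ 2) / 2 - 576 * ((4 : ℕ) : ℝ) * (αh ^ 2 * Real.exp (2 * αh))) / (Fintype.card n : ℝ) - 28 * ((4 : ℕ) : ℝ) * (ε + 7 * αh ^ 2)) →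
    -- ROW NE3's PER-PAIR BINDER on the data class (F31's `hleaves`)
    (∀ D : Site 4 → Fin 4 → (Matrix n n ℂ)ˣ, IsUnitaryCfg D → IsPeriodicCfg D (N : ℤ) → SmallField D (4 * (Real.exp β - 1)) → ∀ (k : ℕ), ∀ Us ∈ admissible (sfClass 4 2 N ε) 2 (k + 1) D, SmallField Us ((1 / ((2 : ℕ) : ℝ) ^ 2 * ε / 2) / (((2 : ℕ) : ℝ) ^ (k + 1)) ^ 2) → (∀ φ : Site 4 → Fin 4 → Matrix n n ℂ, IsSkewDir φ → IsPeriodicDir φ ((N * 2 ^ (k + 1) : ℕ) : ℤ) → TangentIter 2 k Us φ → dAction Us φ (perWin 4 (N * 2 ^ (k + 1))) = 0) → ∀ U' ∈ admissible (sfClass 4 2 N ε) 2 (k + 1) D, ∃ (u : Site 4 → (Matrix n n ℂ)ˣ) (X₀ : Site 4 → Fin 4 → Matrix n n ℂ) (α₀ : ℝ) (m : Site 4 → Fin 4 → ℝ) (C : ℝ), IsSkewDir X₀ ∧ (∀ (hWu : IsUnitaryCfg Us) (hx : 0 ≤ ε / (((2 : ℕ) : ℝ) ^ (k + 1)) ^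 2) (hs : LevelSmall 4 2 k (ε / (((2 : ℕ) : ℝ) ^ (k + 1)) ^ 2)) (hWx : SmallField Us (ε / (((2 : ℕ) : ℝ) ^ (k + 1)) ^ 2)) (hθ : cruxC 4 2 * ((((2 : ℕ) : ℝ) ^ (k + 1)) ^ 2 * (ε / (((2 : ℕ) : ℝ) ^ (k + 1)) ^ 2)) < 1) (hφ : IsSkewDir (dirIter 2 (k + 1) Us X₀)), ResidualSliceRepT 2 N (k + 1) Us U' u X₀ (rightInvW (by norm_num) k hWu hx hs hWx N hθ hφ) α₀) ∧ (∀ z κ, 0 ≤ m z κ) ∧ 0 ≤ C ∧ (((2 : ℕ) : ℝ) ^ (k + 1)) ^ 4 * ∑ z ∈ periodBox (d := 4) N, ∑ κ : Fin 4, m z κ ^ 2 ≤ C ^ 2 * dirSq X₀ (periodBox (d := 4) (N * 2 ^ (k + 1))) ∧ (∀ z ∈ periodBox (d := 4) N, ∀ κ : Fin 4, ‖dirIter 2 (k + 1) Us X₀ z κ‖ ≤ C₂ * (((2 : ℕ) : ℝ) ^ (k + 1) * m z κ) ^ 2) ∧ α₀ * ((2 : ℕ) : ℝ) ^ (k + 1)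 ≤ αh ∧ (∀ z κ, m z κ * ((2 : ℕ) : ℝ) ^ (k + 1) ≤ αh) ∧ C ≤ Ch) →
    ∃ δV : ℝ, 0 < δV ∧
      ∀ V ∈ {V : Site 4 → Fin 4 → (Matrix n n ℂ)ˣ | IsUnitaryCfg V ∧ IsPeriodicCfg V (N : ℤ) ∧ SmallField V δV},
      ∀ k : ℕ, ∃ U : Site 4 → Fin 4 → (Matrix n n ℂ)ˣ, IsMinimiser 4 (sfClass 4 2 N ε) 2 N k V U ∧
        ∃ a : ℝ, 0 ≤ a ∧ a < ε / (((2 : ℕ) : ℝ) ^ k) ^ 2 ∧ SmallField U a := by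
  set nb : ℝ := (nbRad 4 2 : ℝ) with hnb
  have hnb0 : 0 ≤ nb := Nat.cast_nonneg _
  set Acoef : ℝ := 16384 * (2 * nb + 32) with hAcoef
  obtain ⟨ℓ, hℓ1, ε₀, hε₀, H⟩ := hint_of_landauELChart_SU2 (n := n) hn (A := Acoef) (by positivity) 1
  have hℓ0 : (0 : ℝ) ≤ (ℓ : ℝ) := Nat.cast_nonneg ℓ
  set c : ℝ := 2 * nb + 4 * (ℓ : ℝ) + 28 with hc
  have hc1 : 1 ≤ c := by rw [hc]; linarith
  set ε₁ : ℝ := 1 / (25000000000 * c ^ 2) with hε₁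
  refine ⟨ℓ, hℓ1, min ε₀ ε₁, lt_min hε₀ (by positivity), fun ε hε hεle => ?_⟩
  obtain ⟨β₀, hβ₀, H2⟩ := H ε hε (hεle.trans (min_le_left _ _))
  refine ⟨β₀, hβ₀, fun β hβ hβle N _ C₂ αh Ch νh κh hN hC₂ hαh0 hαh1 hCh0 hνh hκh hν hline hleaves => ?_⟩
  have hεε₁ : ε ≤ 1 / (25000000000 * c ^ 2) := hεle.trans (min_le_right _ _)
  refine H2 β hβ hβle N C₂ αh Ch νh κh (16384 * c) hN hC₂ hαh0 hαh1 hCh0 hνh hκh hν hline (by positivity) ?_ ?_ hleaves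
  · -- `c₀ = 16384 c ≤ Acoef (ℓ+1)`
    rw [pow_one, hAcoef, hc]; nlinarith only [mul_nonneg hnb0 hℓ0, hℓ0, hnb0]
  -- (LSUP-EL) from the cube chart
  intro D _ _ _ k U hU _ r hr0 hr hUr z
  have hUu : IsUnitaryCfg U := hU.1.1
  set M : ℝ := ((2 : ℕ) : ℝ) ^ (k + 1) with hM
  have hM2 : 2 ≤ M := by
    rw [hM]; push_cast
    calc (2 : ℝ) = 2 ^ 1 := by norm_num
      _ ≤ 2 ^ (k + 1) := pow_le_pow_right₀ (by norm_num) (by omega)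
  have hM0 : 0 < M := by linarith
  set η : ℝ := (r + ε) / (((2 : ℕ) : ℝ) ^ (k + 1)) ^ 2 with hη
  have hη0 : 0 < η := by positivity
  have hSη : SmallField U η := MinimalActionRate.SmallField.mono hUr (div_le_div_of_nonneg_right (by linarith only [hε]) (by positivity))
  have ht₀ : M ^ 2 * η = r + ε := by rw [hη, hM]; field_simp
  have hr4 : r + ε ≤ 5 / 4 * ε := by have e := hr; norm_num at e; linarith only [e]
  -- the box sizes
  have hRr : ((((nbRad 4 2 + 2 * ℓ + 12) * 2 ^ (k + 1) + 2 : ℕ) : ℝ)) = (nb + 2 * (ℓ : ℝ) + 12) * M + 2 := by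
    rw [hnb, hM]; push_cast; ring
  have hX : ((2 * ((nbRad 4 2 + 2 * ℓ + 12) * 2 ^ (k + 1) + 2) + 2 + 1 : ℕ) : ℝ) ≤ c * M := by
    have h1 : ((2 * ((nbRad 4 2 + 2 * ℓ + 12) * 2 ^ (k + 1) + 2) + 2 + 1 : ℕ) : ℝ) = 2 * ((nb + 2 * (ℓ : ℝ) + 12) * M + 2) + 3 := by
      rw [← hRr]; push_cast; ring
    rw [h1, hc]; linarith only [hM2]
  have hX1 : (1 : ℝ) ≤ ((2 * ((nbRad 4 2 + 2 * ℓ + 12) * 2 ^ (k + 1) + 2) + 2 + 1 : ℕ) : ℝ) := by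
    have : 1 ≤ 2 * ((nbRad 4 2 + 2 * ℓ + 12) * 2 ^ (k + 1) + 2) + 2 + 1 := by omega
    exact_mod_cast this
  have hX₂ : ((2 * ((nbRad 4 2 + 2 * ℓ + 12) * 2 ^ (k + 1) + 2) + 2 : ℕ) : ℝ) ≤ c * M := by
    have h1 : ((2 * ((nbRad 4 2 + 2 * ℓ + 12) * 2 ^ (k + 1) + 2) + 2 : ℕ) : ℝ) = 2 * ((nb + 2 * (ℓ : ℝ) + 12) * M + 2) + 2 := by
      rw [← hRr]; push_cast; ring
    rw [h1, hc]; linarith only [hM2]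
  obtain ⟨hA1, hA2, hA3, hA4⟩ := regime_arith (Nn := (Fintype.card n : ℝ)) hM2 hX hX1 hX₂ (Nat.cast_nonneg _) hc1 hη0 ht₀ hr4 hεε₁
    (by rw [hn]; norm_num)
  obtain ⟨u, A₀, hu, hUA, hskew, hA0, hEL⟩ :=
    cube_landau_chart (n := n) hUu hη0 hSη ((nbRad 4 2 + 2 * ℓ + 12) * 2 ^ (k + 1) + 2) z hA1 hA2 hA3
  refine ⟨u, A₀, hu, hUA, hskew, fun q μ hq => (hA0 q μ hq).trans (hA4.trans ?_), hEL⟩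
  -- `16384 c (r+ε)/M ≤ 16384 c (r + 4(e^β − 1) + ε)/M`
  rw [hM]
  apply div_le_div_of_nonneg_right _ (by positivity)
  apply mul_le_mul_of_nonneg_left _ (by positivity)
  linarith only [Real.add_one_le_exp β, hβ]

end Summit.QuantumFields.BalabanUV.T4Continuum.NE7HintOfUhlenbeckChartSU2
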